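import Summits.ABC.ABC.Theorems.CuspFieldPencilGoldenFromNFPencil
import Summits.ABC.ABC.Theorems.YuMatveevShapeRatCloses
import Summits.ABC.ABC.Theorems.PlacewiseSzpiroSingleTowerSzpiroBakerSinglePlace
import Literature.NumberTheory.DiophantineGeometry.PastenSubexpPlaces
import Literature.Barriers.ABC.BakerMethodBoundsThreeRoutesProofs
import Literature.Barriers.ABC.BakerMethodBoundsStewartYuProofs
import Literature.Barriers.ABC.BakerMethodBoundsStewartTijdemanProofs
import HarnessLib

/-!
# STUB-IDEAS sketch · `stub_splitCuspTriple` · ideator k1 · GEN 4 — FAMILY 1 (RECOGNISE & IMPORT): the hidden abc-triple, three tree routes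

Crux `GoldenCuspShadow` (stmt-ABC-26026), route `CuspFieldPencil`, skeleton sha a4ca286a….
Elaboration-only sketch (no tree proposal): every `sorry` is a PROPOSED HELPER LEMMA; the sorry-free
declarations are (a) ring identities, (b) lemmas IMPORTED VERBATIM from sibling sketches where they are
already proved (credited in the docstring), (c) the composition helper-lemmas ⇒ `PreU` ⇒ `RouteU` ⇒ stub ∧ crux.

IMPORT THESIS.  The identity `w² + Q = u·(u − 11w)` (`Q = u² − 11uw − w²`) is, after sorting signs, an
abc triple `a + b = c` IN ℕ whose two "native" members are `w²` and `|Q|` and whose third ("alien") member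
`M = |u(u−11w)|` is divisible by `u`.  The tree already has Pasten's three place bounds FOR abc TRIPLES, by name:
`Pasten.padic_bound_a` / `Pasten.padic_bound_c` (a prime of `a`, resp. `c`, with `Θ` generated by the OTHER two
members) and `Pasten.arch_bound` (`log c − log a < Θ_{b,c}·Y`).  Reading them on the hidden triple with `u ∣ M`:
* p-adic, primes of `u` only (divisor form, PROVED in the sibling sketch `ConjK1G3`): `log|u| ≤ Θ·Y·3Σ_{p∣u} p`,
  `Θ = theta K x y 0` with `{x,y} = {|Q|, w²}` — the primes of `u − 11w` never enter `Θ`;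
* archimedean (`arch_bound`, only when `M` is a summand; free when `M` is the top): `log H ≤ log|u| + log 12 + Θ·Y`.
This is the FRONT END (`RawU`).  ABSORPTION (`Θ ≤ K·C·R^η`: `SingleTowerSzpiroLine.theta_zero_le_mul_rpow`;
`1 + 3Σ_{p∣u}p ≤ 4 rad u`: `StewartTijdeman.sum_le_prod_of_two_le`; `Y ≤ 3·log max(e, 2 log H)`) gives `PreU`, the SAME
seam as k2-GEN4's `routeU_of_pre`; the BACK END (`PreU → RouteU → RouteW → CuspMinRadBound → stub ∧ crux`,
self-improvement `StewartYu.le_of_le_mul_log_max`) is architecture-independent and shared with k2.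
-/

set_option linter.dupNamespace false
set_option linter.unusedVariables false

noncomputable section

open Finset Real Height
open Literature.NumberTheory.DiophantineGeometry
open Literature.NumberTheory.DiophantineGeometry.Dioph
open Literature.NumberTheory.DiophantineGeometry.Pasten
open Literature.Barriers.ABC
open Summit.ABC.ABC.Theorems
open Summit.ABC.ABC.Theorems.GoldenFromNFPencil

namespace Summit.ABC.ABC.Cruxes.GoldenCuspShadow.SplitK1G4

/-! ## 0 · Statements: the stub (verbatim), the one-cusp targets, the min-form, the seam `PreU` -/

/-- The registered stub signature `stub_splitCuspTriple`, verbatim. -/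
def StubSplit : Prop :=
  ∀ ε : ℝ, 0 < ε → ∃ κ : ℝ, ∀ u w : ℤ, IsCoprime u w → u * w * (u ^ 2 - 11 * u * w - w ^ 2) ≠ 0 → Real.log (max (|(u : ℝ)|) (|(w : ℝ)|)) ≤ κ * (((UniqueFactorizationMonoid.radical (u * w * (u ^ 2 - 11 * u * w - w ^ 2))).natAbs : ℕ) : ℝ) ^ (ε : ℝ) * (((((UniqueFactorizationMonoid.radical u).natAbs : ℕ) : ℝ) * (((UniqueFactorizationMonoid.radical w).natAbs : ℕ) : ℝ)) ^ (2 / 3 : ℝ) * (((UniqueFactorizationMonoid.radical (u ^ 2 - 11 * u * w - w ^ 2)).natAbs : ℕ) : ℝ) ^ (1 / 3 : ℝ))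

/-- `Q(u,w) = u² − 11uw − w²`. -/
abbrev Q (u w : ℤ) : ℤ := u ^ 2 - 11 * u * w - w ^ 2

/-- `H(u,w) = max(|u|,|w|)` as a real number. -/
abbrev H (u w : ℤ) : ℝ := max |(u : ℝ)| |(w : ℝ)|

/-- The alien member `M = u·(u − 11w)` of the hidden triple `w² + Q = M`. -/
abbrev Mem (u w : ℤ) : ℤ := u * (u - 11 * w)

/-- `Y(c) = log max(e, 2 log c)` — the log-log factor of the tree's place bounds for a triple with top `c`. -/
abbrev Yc (c : ℕ) : ℝ := Real.log (max (Real.exp 1) (2 * Real.log c))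

/-- ONE-CUSP TARGET at `t = 0`: `log H ≤ κ_ε · rad(uwQ)^ε · rad u` (same text as k2-GEN4 `RouteU`). -/
def RouteU : Prop :=
  ∀ ε : ℝ, 0 < ε → ∃ κ : ℝ, ∀ u w : ℤ, IsCoprime u w → u * w * (u ^ 2 - 11 * u * w - w ^ 2) ≠ 0 →
    Real.log (max (|(u : ℝ)|) (|(w : ℝ)|)) ≤
      κ * (((UniqueFactorizationMonoid.radical (u * w * (u ^ 2 - 11 * u * w - w ^ 2))).natAbs : ℕ) : ℝ) ^ (ε : ℝ) *
        (((UniqueFactorizationMonoid.radical u).natAbs : ℕ) : ℝ)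

/-- ONE-CUSP TARGET at `t = ∞` (same text as k2-GEN4 `RouteW`). -/
def RouteW : Prop :=
  ∀ ε : ℝ, 0 < ε → ∃ κ : ℝ, ∀ u w : ℤ, IsCoprime u w → u * w * (u ^ 2 - 11 * u * w - w ^ 2) ≠ 0 →
    Real.log (max (|(u : ℝ)|) (|(w : ℝ)|)) ≤
      κ * (((UniqueFactorizationMonoid.radical (u * w * (u ^ 2 - 11 * u * w - w ^ 2))).natAbs : ℕ) : ℝ) ^ (ε : ℝ) *
        (((UniqueFactorizationMonoid.radical w).natAbs : ℕ) : ℝ)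

/-- The min-form (same text as k2-GEN2/3/4 `CuspMinRadBound`, = `ConjK1G3.UWMinRad`, = `SideaK2G3.UWHalf`). -/
def CuspMinRadBound : Prop :=
  ∀ ε : ℝ, 0 < ε → ∃ κ : ℝ, ∀ u w : ℤ, IsCoprime u w → u * w * (u ^ 2 - 11 * u * w - w ^ 2) ≠ 0 →
    Real.log (max (|(u : ℝ)|) (|(w : ℝ)|)) ≤
      κ * (((UniqueFactorizationMonoid.radical (u * w * (u ^ 2 - 11 * u * w - w ^ 2))).natAbs : ℕ) : ℝ) ^ (ε : ℝ) *
        min ((((UniqueFactorizationMonoid.radical u).natAbs : ℕ) : ℝ))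
            ((((UniqueFactorizationMonoid.radical w).natAbs : ℕ) : ℝ))

/-- THE SEAM between front end and back end (same text as the hypothesis of k2-GEN4 `routeU_of_pre`):
for every `η > 0` a constant `A ≥ 1` with `log H ≤ A · R^η · rad u · log max(e, 2 log H)` for ALL admissible pairs. -/
def PreU : Prop :=
  ∀ η : ℝ, 0 < η → ∃ A : ℝ, 1 ≤ A ∧ ∀ u w : ℤ, IsCoprime u w → u * w * Q u w ≠ 0 →
    Real.log (H u w) ≤
      A * (((UniqueFactorizationMonoid.radical (u * w * Q u w)).natAbs : ℕ) : ℝ) ^ η *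
        (((UniqueFactorizationMonoid.radical u).natAbs : ℕ) : ℝ) *
        Real.log (max (Real.exp 1) (2 * Real.log (H u w)))

/-- FRONT-END OUTPUT for one pair: some ordering `{x,y} = {|Q|, w²}` of the native members and some top `c ≤ 13H²`
such that the divisor-restricted p-adic route through `u` and the archimedean transfer hold with `Θ = theta K x y 0`. -/
def RawU (K : ℝ) (u w : ℤ) : Prop :=
  ∃ x y c : ℕ, x * y = (Q u w).natAbs * w.natAbs ^ 2 ∧ x ≠ 0 ∧ y ≠ 0 ∧ x.Coprime y ∧ 0 < c ∧
    (c : ℝ) ≤ 13 * H u w ^ 2 ∧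
    Real.log |(u : ℝ)| ≤ theta K x y 0 * Yc c * (3 * ∑ p ∈ u.natAbs.primeFactors, (p : ℝ)) ∧
    Real.log (H u w) ≤ Real.log |(u : ℝ)| + Real.log 12 + theta K x y 0 * Yc c

/-! ## 1 · Algebra (proved; `tU`/`Q_swap`/`prod_swap`/`natAbs_radical_cast` as in k2-GEN3/4, k1-GEN3) -/

/-- `T₀ : w² + Q = u(u − 11w)` — the hidden triple. -/
theorem tU (u w : ℤ) : w ^ 2 + Q u w = Mem u w := by
  simp only [Q, Mem]; ring

/-- The cusp swap `(u, w) ↦ (w, −u)` negates `Q` … -/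
theorem Q_swap (u w : ℤ) : Q w (-u) = -Q u w := by
  simp only [Q]; ring

/-- … and fixes the product `u·w·Q` literally. -/
theorem prod_swap (u w : ℤ) : w * (-u) * Q w (-u) = u * w * Q u w := by
  simp only [Q]; ring

/-- `(radical z).natAbs`, as a real, is the product of the rational primes of `z` (k2-GEN3 `natAbs_radical_cast`, proved there). -/
theorem natAbs_radical_cast (z : ℤ) :
    (((UniqueFactorizationMonoid.radical z).natAbs : ℕ) : ℝ) = ∏ p ∈ z.natAbs.primeFactors, (p : ℝ) := by
  rw [← Int.radical_natAbs_eq_radical, Int.natAbs_natCast, Nat.radical_eq_prod_primeFactors, Nat.cast_prod]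

/-! ## 2 · FRONT END — the hidden abc-triple and the three tree routes

F1/F1' are IMPORTED (proved verbatim in `ConjK1G3`, `STUB_IDEAS_stub_conjugateCuspTriple_1_g3_Sketch.lean`);
F2–F6 are the new helpers (all XS–S−), F7 the front-end assembly (M−). -/

/-- **F1 (PROVED, import of `ConjK1G3.log_le_of_dvd_a`)** divisor-restricted route through `a`:
for an abc triple and `d ∣ a`, `log d ≤ Θ_{bc} · Y(c) · 3Σ_{p∣d} p` (`Pasten.padic_bound_a`, `div_log_mul_add_le`,
`log_eq_sum_factorization_mul_log`). -/
theorem log_le_of_dvd_a {K : ℝ} (hK : 1 ≤ K) (hP : PastenApproximationBound K) {a b c : ℕ}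
    (h : IsABCTriple a b c) {d : ℕ} (hd : d ∣ a) :
    Real.log d ≤ theta K b c 0 * Yc c * (3 * ∑ p ∈ d.primeFactors, (p : ℝ)) := by
  obtain ⟨ha, hb, habc, hcop⟩ := id h
  set Θ := theta K b c 0 with hΘ
  set Y := Yc c with hY
  have hY1 : 1 ≤ Y := one_le_log_max_exp _
  have hΘ0 : 0 ≤ Θ := theta_nonneg (zero_le_one.trans hK) b c 0
  have hd0 : d ≠ 0 := (Nat.pos_of_dvd_of_pos hd ha).ne'
  have hlogd : Real.log d = ∑ p ∈ d.primeFactors, (d.factorization p : ℝ) * Real.log p :=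
    log_eq_sum_factorization_mul_log hd0
  have hsum : ∑ p ∈ d.primeFactors, (d.factorization p : ℝ) * Real.log p ≤
      ∑ p ∈ d.primeFactors, Θ * (3 * p * Y) := by
    refine Finset.sum_le_sum fun p hp => ?_
    have hp' := Nat.prime_of_mem_primeFactors hp
    have hpa : p ∣ a := (Nat.dvd_of_mem_primeFactors hp).trans hd
    have h1 := padic_bound_a hK hP h 0 hp' hpa
    have h2 : (p : ℝ) / Real.log p * (Real.log p + Y) ≤ 3 * p * Y :=
      div_log_mul_add_le (by exact_mod_cast hp'.two_le) hY1
    have hfac : (d.factorization p : ℝ) ≤ a.factorization p := by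
      exact_mod_cast Finsupp.le_def.mp ((Nat.factorization_le_iff_dvd hd0 ha.ne').mpr hd) p
    have hlogp : 0 ≤ Real.log p := Real.log_nonneg (by exact_mod_cast hp'.one_lt.le)
    calc (d.factorization p : ℝ) * Real.log p ≤ (a.factorization p : ℝ) * Real.log p :=
          mul_le_mul_of_nonneg_right hfac hlogp
      _ ≤ Θ * ((p : ℝ) / Real.log p * (Real.log p + Y)) := h1.le
      _ ≤ Θ * (3 * p * Y) := mul_le_mul_of_nonneg_left h2 hΘ0
  have hsum' : ∑ p ∈ d.primeFactors, Θ * (3 * p * Y) =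
      Θ * Y * (3 * ∑ p ∈ d.primeFactors, (p : ℝ)) := by
    rw [Finset.mul_sum, Finset.mul_sum]
    exact Finset.sum_congr rfl fun p _ => by ring
  rw [hlogd, ← hsum']; exact hsum

/-- **F1' (PROVED, import of `ConjK1G3.log_le_of_dvd_c`)** divisor-restricted route through `c` (`ab > 1`):
`d ∣ c ⇒ log d ≤ Θ_{ab} · Y(c) · 3Σ_{p∣d} p` (`Pasten.padic_bound_c`). -/
theorem log_le_of_dvd_c {K : ℝ} (hK : 1 ≤ K) (hP : PastenApproximationBound K) {a b c : ℕ}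
    (h : IsABCTriple a b c) (h1 : 1 < a * b) {d : ℕ} (hd : d ∣ c) :
    Real.log d ≤ theta K a b 0 * Yc c * (3 * ∑ p ∈ d.primeFactors, (p : ℝ)) := by
  obtain ⟨ha, hb, habc, hcop⟩ := id h
  set Θ := theta K a b 0 with hΘ
  set Y := Yc c with hY
  have hc : 0 < c := by omega
  have hY1 : 1 ≤ Y := one_le_log_max_exp _
  have hΘ0 : 0 ≤ Θ := theta_nonneg (zero_le_one.trans hK) a b 0
  have hd0 : d ≠ 0 := (Nat.pos_of_dvd_of_pos hd hc).ne'
  have hlogd : Real.log d = ∑ p ∈ d.primeFactors, (d.factorization p : ℝ) * Real.log p :=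
    log_eq_sum_factorization_mul_log hd0
  have hsum : ∑ p ∈ d.primeFactors, (d.factorization p : ℝ) * Real.log p ≤
      ∑ p ∈ d.primeFactors, Θ * (3 * p * Y) := by
    refine Finset.sum_le_sum fun p hp => ?_
    have hp' := Nat.prime_of_mem_primeFactors hp
    have hpc : p ∣ c := (Nat.dvd_of_mem_primeFactors hp).trans hd
    have h1 := padic_bound_c hK hP h h1 0 hp' hpc
    have h2 : (p : ℝ) / Real.log p * (Real.log p + Y) ≤ 3 * p * Y :=
      div_log_mul_add_le (by exact_mod_cast hp'.two_le) hY1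
    have hfac : (d.factorization p : ℝ) ≤ c.factorization p := by
      exact_mod_cast Finsupp.le_def.mp ((Nat.factorization_le_iff_dvd hd0 hc.ne').mpr hd) p
    have hlogp : 0 ≤ Real.log p := Real.log_nonneg (by exact_mod_cast hp'.one_lt.le)
    calc (d.factorization p : ℝ) * Real.log p ≤ (c.factorization p : ℝ) * Real.log p :=
          mul_le_mul_of_nonneg_right hfac hlogp
      _ ≤ Θ * ((p : ℝ) / Real.log p * (Real.log p + Y)) := h1.le
      _ ≤ Θ * (3 * p * Y) := mul_le_mul_of_nonneg_left h2 hΘ0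
  have hsum' : ∑ p ∈ d.primeFactors, Θ * (3 * p * Y) =
      Θ * Y * (3 * ∑ p ∈ d.primeFactors, (p : ℝ)) := by
    rw [Finset.mul_sum, Finset.mul_sum]
    exact Finset.sum_congr rfl fun p _ => by ring
  rw [hlogd, ← hsum']; exact hsum

/-- **F2 (XS)** `gcd(|Q|, w²) = 1` — import of `GoldenFromNFPencil.isCoprime_quadForm_right` (`Int.gcd` is the
`Nat.gcd` of the `natAbs`), then `Nat.Coprime.pow_right`.  Same text as k2-GEN4 `coprime_xy_u` (E5). -/
theorem coprime_Q_wsq {u w : ℤ} (h : IsCoprime u w) : ((Q u w).natAbs).Coprime (w.natAbs ^ 2) := by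
  have h1 : Int.gcd (Q u w) w = 1 := Int.isCoprime_iff_gcd_eq_one.mp (isCoprime_quadForm_right h).symm
  exact Nat.Coprime.pow_right 2 h1

/-- **F3 (XS)** sign sorting: off the escape `u = 11w`, exactly one of (i) `Q > 0` (then `M = w² + Q > 0` is the
top), (ii) `Q < 0 < M` (`w² = M + |Q|` is the top), (iii) `M < 0` (then `Q = M − w² < 0`, `|Q| = |M| + w²` is the top). -/
theorem sign_cases {u w : ℤ} (h0 : u * w * Q u w ≠ 0) (hne : u - 11 * w ≠ 0) :
    0 < Q u w ∨ (Q u w < 0 ∧ 0 < Mem u w) ∨ Mem u w < 0 := by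
  sorry

/-- **F4i (S−)** case (i): `(a,b,c) = (|Q|, w², |M|)` is an abc triple (`tU`, positivity, F2; sum in ℕ via `zify`/`abs_of_pos`). -/
theorem triple_i {u w : ℤ} (h : IsCoprime u w) (h0 : u * w * Q u w ≠ 0) (hQ : 0 < Q u w) :
    IsABCTriple (Q u w).natAbs (w.natAbs ^ 2) (Mem u w).natAbs := by
  sorry

/-- **F4ii (S−)** case (ii): `(a,b,c) = (|M|, |Q|, w²)` is an abc triple (coprimality of the summands from F2:
`gcd(a,b) ∣ gcd(b, a+b) = gcd(|Q|, w²) = 1`, `Nat.Coprime.coprime_add_self_right`-type lemma). -/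
theorem triple_ii {u w : ℤ} (h : IsCoprime u w) (h0 : u * w * Q u w ≠ 0) (hQ : Q u w < 0) (hM : 0 < Mem u w) :
    IsABCTriple (Mem u w).natAbs (Q u w).natAbs (w.natAbs ^ 2) := by
  sorry

/-- **F4iii (S−)** case (iii): `(a,b,c) = (|M|, w², |Q|)` is an abc triple. -/
theorem triple_iii {u w : ℤ} (h : IsCoprime u w) (h0 : u * w * Q u w ≠ 0) (hM : Mem u w < 0) :
    IsABCTriple (Mem u w).natAbs (w.natAbs ^ 2) (Q u w).natAbs := by
  sorry

/-- **F5 (S−)** `x·y > 1` off the escape (needed by `padic_bound_c` in case (i) as `1 < a*b`): `|Q|·w² = 1` forces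
`w = ±1`, `|Q| = 1`, `u(u ∓ 11) = w² + Q ∈ {0, 2}` — `0` is the escape, `2` has no solution (`u ∣ 2`, four cases).
Same text as k2-GEN4 `one_lt_xy_u` (E3). -/
theorem one_lt_xy_u {u w : ℤ} (h : IsCoprime u w) (h0 : u * w * Q u w ≠ 0) (hne : u - 11 * w ≠ 0) :
    1 < (Q u w).natAbs * w.natAbs ^ 2 := by
  sorry

/-- **F6 (S−, pure real inequality)** the REGIME-FREE TRANSFER: if `2 log|w| ≤ log|u| + log|u − 11w| + T` with `T ≥ 0`
then `log H ≤ log|u| + log 12 + T` (case `|w| ≤ |u|`: trivial; case `|u| < |w|`: `|u − 11w| < 12|w|`). -/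
theorem transfer {u w : ℤ} (hu : u ≠ 0) (hw : w ≠ 0) {T : ℝ} (hT : 0 ≤ T)
    (hkey : 2 * Real.log |(w : ℝ)| ≤ Real.log |(u : ℝ)| + Real.log |((u - 11 * w : ℤ) : ℝ)| + T) :
    Real.log (H u w) ≤ Real.log |(u : ℝ)| + Real.log 12 + T := by
  sorry

/-- **F6i (XS–S−)** key inequality in case (i), with `T = 0`: `w² ≤ w² + Q = |u|·|u − 11w|` (`Real.log_le_log`, `Real.log_mul`, casts). -/
theorem key_i {u w : ℤ} (h0 : u * w * Q u w ≠ 0) (hQ : 0 < Q u w) :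
    2 * Real.log |(w : ℝ)| ≤ Real.log |(u : ℝ)| + Real.log |((u - 11 * w : ℤ) : ℝ)| + 0 := by
  sorry

/-- **F6ii (S−, cast bookkeeping)** key inequality in case (ii) from `Pasten.arch_bound` on `triple_ii`:
`log c − log a = 2 log|w| − log|M| < Θ·Y` and `log|M| = log|u| + log|u − 11w|`. -/
theorem key_ii {u w : ℤ} (h0 : u * w * Q u w ≠ 0) (hne : u - 11 * w ≠ 0) {T : ℝ}
    (harch : Real.log ((w.natAbs ^ 2 : ℕ) : ℝ) - Real.log (((Mem u w).natAbs : ℕ) : ℝ) < T) :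
    2 * Real.log |(w : ℝ)| ≤ Real.log |(u : ℝ)| + Real.log |((u - 11 * w : ℤ) : ℝ)| + T := by
  sorry

/-- **F6iii (S−)** key inequality in case (iii) from `Pasten.arch_bound` on `triple_iii`:
`log|Q| − log|M| < Θ·Y` and `w² ≤ w² + |M| = |Q|`. -/
theorem key_iii {u w : ℤ} (h0 : u * w * Q u w ≠ 0) (hne : u - 11 * w ≠ 0) (hM : Mem u w < 0) {T : ℝ}
    (harch : Real.log (((Q u w).natAbs : ℕ) : ℝ) - Real.log (((Mem u w).natAbs : ℕ) : ℝ) < T) :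
    2 * Real.log |(w : ℝ)| ≤ Real.log |(u : ℝ)| + Real.log |((u - 11 * w : ℤ) : ℝ)| + T := by
  sorry

/-- **F7 (M−, front-end assembly, ~50 lines of case bookkeeping)** `RawU K u w` off the escape:
sign_cases; in each case the triple (F4), `|u| ∣ |M|` (`Int.natAbs_mul`, `dvd_mul_right`), the p-adic piece by
F1' (case i, with F5 and `mul_comm`) / F1 (cases ii, iii) read at `d = |u|` (`Nat.cast_natAbs`/`Int.cast_abs`),
the transfer F6 fed by F6i / F6ii+`arch_bound` / F6iii+`arch_bound` (`T = Θ·Y ≥ 0` by `theta_nonneg`,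
`one_le_log_max_exp`), and the sizes `c ≤ 13H²` (`|M| ≤ 12H²`, `w² ≤ H²`, `|Q| ≤ 13H²`). -/
theorem rawU_of_pasten {K : ℝ} (hK : 1 ≤ K) (hP : PastenApproximationBound K) {u w : ℤ}
    (h : IsCoprime u w) (h0 : u * w * Q u w ≠ 0) (hne : u - 11 * w ≠ 0) : RawU K u w := by
  sorry

/-! ## 3 · ABSORPTION — `RawU ⇒ PreU` (tree lemmas by name) -/

/-- **B1 (S, radical bookkeeping)** for `{x,y} = {|Q|, w²}` (as a product): `rad x y |u| = rad(u·w·Q)` in ℕ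
(`rad_def`, `Nat.primeFactors_mul`, `Nat.primeFactors_pow`, `Int.natAbs_mul`, `Nat.radical_eq_prod_primeFactors`).
Cf. k2-GEN4 `rad_aux_eq` (T0): same content, product form. -/
theorem rad_xy_eq {u w : ℤ} (h0 : u * w * Q u w ≠ 0) {x y : ℕ} (hxy : x * y = (Q u w).natAbs * w.natAbs ^ 2) :
    rad x y u.natAbs = (UniqueFactorizationMonoid.radical (u * w * Q u w)).natAbs := by
  sorry

/-- **B2 (XS after B1)** `Θ ≤ K·C·R^η` — ONE call of `SingleTowerSzpiroLine.theta_zero_le_mul_rpow` with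
`(u,v,a,b,c) := (x, y, x, y, |u|)`, `hdvd := dvd_mul_right _ _`, then B1. -/
theorem theta_xy_le {K C η : ℝ} (hK : 1 ≤ K) (hη : 0 ≤ η)
    (hC : ∀ S : Finset ℕ, (∀ p ∈ S, p.Prime) → ∏ p ∈ S, K * Real.log p / (p : ℝ) ^ η ≤ C)
    {u w : ℤ} (h0 : u * w * Q u w ≠ 0) {x y : ℕ} (hxy : x * y = (Q u w).natAbs * w.natAbs ^ 2)
    (hx : x ≠ 0) (hy : y ≠ 0) (hcop : x.Coprime y) :
    theta K x y 0 ≤ K * C * (((UniqueFactorizationMonoid.radical (u * w * Q u w)).natAbs : ℕ) : ℝ) ^ η := by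
  have hu : u.natAbs ≠ 0 := Int.natAbs_ne_zero.mpr (by rintro rfl; simp at h0)
  have h3 : x * y * u.natAbs ≠ 0 := mul_ne_zero (mul_ne_zero hx hy) hu
  have key := SingleTowerSzpiroLine.theta_zero_le_mul_rpow hK hη hC hx hy hcop (dvd_mul_right (x * y) u.natAbs) h3
  rwa [rad_xy_eq h0 hxy] at key

/-- **B3 (S, numerics)** `Y(c) ≤ 3 · log max(e, 2 log H)` for `0 < c ≤ 13H²`, `H ≥ 1`
(`2 log c ≤ 2 log 13 + 4 log H`; at `2 log H ≤ e`: LHS `≤ log 10.6 < 3`; beyond: `5.2 + 4y ≤ 8y³`). -/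
theorem Yc_le {c : ℕ} (hc : 0 < c) {Hr : ℝ} (hH : 1 ≤ Hr) (hcH : (c : ℝ) ≤ 13 * Hr ^ 2) :
    Yc c ≤ 3 * Real.log (max (Real.exp 1) (2 * Real.log Hr)) := by
  sorry

/-- **B4 (XS)** `1 + 3Σ_{p∣u} p ≤ 4 · rad u` — `StewartTijdeman.sum_le_prod_of_two_le` + `natAbs_radical_cast`, `rad u ≥ 1`.
Same text as k2-GEN4 `one_add_three_sum_le` (J3). -/
theorem one_add_three_sum_le {u : ℤ} (hu : u ≠ 0) :
    1 + 3 * ∑ p ∈ u.natAbs.primeFactors, (p : ℝ) ≤ 4 * (((UniqueFactorizationMonoid.radical u).natAbs : ℕ) : ℝ) := by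
  sorry

/-- **B5 (XS)** the escape `u = 11w` forces `(u,w) = ±(11,1)` (`w` is a unit by coprimality), so `H = 11`.
Same text as k2-GEN4 `escape_u` (E1). -/
theorem escape_u {u w : ℤ} (h : IsCoprime u w) (he : u - 11 * w = 0) : H u w = 11 := by
  sorry

/-- **B6 (M−, absorption assembly, ~40 lines)** `RawU` everywhere off the escape ⇒ `PreU`:
`C` from `SingleTowerSzpiroLine.exists_prod_mul_log_div_rpow_le (A := K)`; escape by B5 (`log 11 ≤ A`, all factors `≥ 1`);
else `log H ≤ log 12 + Θ·Y·(1 + 3Σ) ≤ log 12 + (K C R^η)(3L)(4 rad u)`, `A := log 12 + 12·K·C`. -/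
theorem preU_of_rawU {K : ℝ} (hK : 1 ≤ K)
    (hraw : ∀ u w : ℤ, IsCoprime u w → u * w * Q u w ≠ 0 → u - 11 * w ≠ 0 → RawU K u w) : PreU := by
  sorry

/-! ## 4 · BACK END — architecture-independent (same statements as k2-GEN4 G2, G3, R0, R1, R2: land ONCE) -/

/-- **G2 (S+)** self-improvement: `PreU → RouteU` (`η := min(ε,1)/3`, `M := A R^η rad u ≥ 1`,
`StewartYu.le_of_le_mul_log_max` ⇒ `log H ≤ 2M log 4M`, `Real.log_le_rpow_div`, `rad u ≤ R` by `natAbs_radical_prod`). -/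
theorem routeU_of_preU : PreU → RouteU := by
  sorry

/-- **G3 (S)** the cusp swap `t ↦ −1/t`: `RouteU → RouteW` via `(w, −u)` (`IsCoprime.neg_right`, `prod_swap`, `abs_neg`,
`max_comm`, `radical (-u)` by `Int.radical_natAbs_eq_radical`). -/
theorem routeW_of_routeU : RouteU → RouteW := by
  sorry

/-- **R0 (XS)** `RouteU → RouteW → CuspMinRadBound` (`κ := max (max κ_U κ_W) 0`, `min_le_left/right`). -/
theorem cuspMinRadBound_of_routes : RouteU → RouteW → CuspMinRadBound := by
  sorry

/-- **R1 (S)** min-form ⇒ STUB: `min x y ≤ (xy)^{2/3}` for `x,y ≥ 1`, `1 ≤ (rad Q)^{1/3}` (`Real.one_le_rpow`). -/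
theorem stubSplit_of_cuspMinRadBound : CuspMinRadBound → StubSplit := by
  sorry

/-- **R2 (S)** min-form ⇒ CRUX: `min(rad u, rad w) ≤ (rad u · rad w)^{1/2} ≤ R^{1/2}` (`natAbs_radical_prod`), `R^ε R^{1/2} = R^{1/2+ε}`. -/
theorem goldenCuspShadow_of_cuspMinRadBound :
    CuspMinRadBound → Summit.ABC.ABC.Theses.CuspFieldPencil.GoldenCuspShadow := by
  sorry

/-! ## 5 · Assembly (sorry-free): tree theorem ⇒ front end ⇒ seam ⇒ back end ⇒ stub ∧ crux -/

/-- The seam from any `K ≥ 1` carrying `PastenApproximationBound K`. -/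
theorem preU_of_pasten {K : ℝ} (hK : 1 ≤ K) (hP : PastenApproximationBound K) : PreU :=
  preU_of_rawU hK fun _ _ h h0 hne => rawU_of_pasten hK hP h h0 hne

/-- `RouteU` outright: the only external input is the KERNEL THEOREM `approximationBound_rat_holds`. -/
theorem routeU_holds : RouteU := by
  obtain ⟨K, hK, hP⟩ := approximationBound_rat_holds
  exact routeU_of_preU (preU_of_pasten hK hP)

theorem routeW_holds : RouteW := routeW_of_routeU routeU_holds

theorem cuspMinRadBound_holds : CuspMinRadBound := cuspMinRadBound_of_routes routeU_holds routeW_holds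

/-- THE STUB, modulo the sorried helpers only (land with the VERBATIM header `theorem stub_splitCuspTriple : <sig> := …`). -/
theorem stubSplit_holds : StubSplit := stubSplit_of_cuspMinRadBound cuspMinRadBound_holds

/-- THE CRUX by name, modulo the sorried helpers only. -/
theorem goldenCuspShadow_holds : Summit.ABC.ABC.Theses.CuspFieldPencil.GoldenCuspShadow :=
  goldenCuspShadow_of_cuspMinRadBound cuspMinRadBound_holds

/-! ## 6 · Kernel-checked unit tests: the three sign cases are all realised, and are abc triples -/

/-- case (i) at `(12, 1)`: `Q = 11 > 0`, `M = 12`, triple `11 + 1 = 12`. -/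
example : Q 12 1 = 11 ∧ Mem 12 1 = 12 ∧ IsABCTriple (Q 12 1).natAbs ((1 : ℤ).natAbs ^ 2) (Mem 12 1).natAbs := by
  simp only [IsABCTriple]; decide

/-- case (ii) at `(−1, 12)`: `Q = −11 < 0 < M = 133`, triple `133 + 11 = 144`. -/
example : Q (-1) 12 = -11 ∧ Mem (-1) 12 = 133 ∧
    IsABCTriple (Mem (-1) 12).natAbs (Q (-1) 12).natAbs ((12 : ℤ).natAbs ^ 2) := by
  simp only [IsABCTriple]; decide

/-- case (iii) at `(1, 1)`: `M = −10 < 0`, `Q = −11`, triple `10 + 1 = 11`. -/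
example : Q 1 1 = -11 ∧ Mem 1 1 = -10 ∧ IsABCTriple (Mem 1 1).natAbs ((1 : ℤ).natAbs ^ 2) (Q 1 1).natAbs := by
  simp only [IsABCTriple]; decide

/-- the escape `(11, 1)` is exactly where `M = 0` (no triple; handled by B5 before the front end). -/
example : Mem 11 1 = 0 ∧ Q 11 1 = -1 := by decide

end Summit.ABC.ABC.Cruxes.GoldenCuspShadow.SplitK1G4

end
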